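import Mathlib
import Summits.ValiantsHypothesis.ValiantsHypothesis.Theorems.DivisionGapPerMultiplesHardStubLevelSlice
import Summits.ValiantsHypothesis.ValiantsHypothesis.Theorems.DivisionGapPerMultiplesHardStubBoardCompressionGen
import Summits.ValiantsHypothesis.ValiantsHypothesis.Theorems.DivisionGapPerMultiplesHardThinPatterns
import Literature.Computability.AlgebraicComplexity.ArithCircuitProofs
import Literature.Computability.AlgebraicComplexity.PermanentIrreducible

/-!
# `DivisionGap.PerMultiplesHard` (stmt-ValiantsHypothesis-5068), line `uncharged-face-walk`:
the deep pure count, part 1 — level bounds (stub `levelBoundB`; lead c3)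

Pieces of the LEVEL-SET RECURSION behind `deepPureCount` (part 2, module `…DeepPureCount`).
A PURE exponent of a polynomial on the `m × m` board is one supported inside the graph
`{(σ j, j)}` of a permutation `σ`.  For a typed factor `a` (row margins `ρ`, column margins `γ`)
a pure exponent inside `π` forces `γ = ρ ∘ π`, so `π` maps every column level `{γ = v}` onto the
row level `{ρ = v}`; slicing a level out is free (`LevelSlice.stub_levelSlice`, landed), the
slice lives on its own `k_v`-board with constant margins (`BoardCompressionGen`, landed), and
there the depth-`D` bound (induction hypothesis, passed as an explicit hypothesis `ih`) or the
trivial bound `k_v!` applies.  Contents: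
* elementary facts on pure exponents (`pure_of_le`, `pure_filter`, `card_pure_le_factorial`,
  `card_pure_sum_le`), the general margins split `margins_split_gen`, level bookkeeping
  (`sum_card_levels`, `filter_congr_iff`);
* the arithmetic of the recursion (`const_step`, `expo_step`, `threshold_big`, `threshold_compl`,
  `sum_sub_div_three_le`);
* the a-side level bound `a_level_bound` (big level: `ih`; small level: `k_v!`) and the b-side
  bound `levelBoundB` (the level `ρ = 0` of the complement factor, always big).
[cite: JerrumSnir1982, §3–§4.3]
-/

noncomputable section

open MvPolynomial Literature.Computability.AlgebraicComplexity
open scoped NNReal BigOperators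
open Summit.ValiantsHypothesis.ValiantsHypothesis.Theorems.DivisionGap.PerMultiplesHard

namespace Summit.ValiantsHypothesis.ValiantsHypothesis.Theorems.DivisionGap.PerMultiplesHard.DeepPureCount

/-! ### Pure exponents: elementary facts -/

/-- A sub-exponent of a pure exponent is pure (served by the same permutation). [folklore] -/
theorem pure_of_le {m : ℕ} {M A : (Fin m × Fin m) →₀ ℕ} {σ : Equiv.Perm (Fin m)}
    (hM : ∀ e ∈ M.support, e.1 = σ e.2) (hA : A ≤ M) : ∀ e ∈ A.support, e.1 = σ e.2 := by
  intro e he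
  refine hM e (Finsupp.mem_support_iff.2 fun h0 => ?_)
  have h1 : A e ≤ M e := hA e
  rw [h0, Nat.le_zero] at h1
  exact (Finsupp.mem_support_iff.1 he) h1

/-- A filter of a pure exponent is pure. [folklore] -/
theorem pure_filter {m : ℕ} {A : (Fin m × Fin m) →₀ ℕ} {σ : Equiv.Perm (Fin m)}
    (hA : ∀ e ∈ A.support, e.1 = σ e.2) (p : Fin m × Fin m → Prop) [DecidablePred p] :
    ∀ e ∈ (A.filter p).support, e.1 = σ e.2 := by
  intro e he
  rw [Finsupp.support_filter, Finset.mem_filter] at he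
  exact hA e he.1

/-- **Pure exponents with constant column margins are multiples of permutation matrices**, so a
polynomial all of whose exponents have column margins `v ≥ 1` has at most `m!` pure exponents.
[folklore] -/
theorem card_pure_le_factorial {m v : ℕ} (hv : 1 ≤ v) (c : MvPolynomial (Fin m × Fin m) ℝ≥0)
    (hc : ∀ M ∈ c.support, ∀ j, ∑ i, M (i, j) = v) :
    (c.support.filter fun M => ∃ σ : Equiv.Perm (Fin m), ∀ e ∈ M.support, e.1 = σ e.2).card ≤
      m.factorial := by
  classical
  have hsub : (c.support.filter fun M => ∃ σ : Equiv.Perm (Fin m), ∀ e ∈ M.support, e.1 = σ e.2) ⊆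
      (Finset.univ : Finset (Equiv.Perm (Fin m))).image (fun σ => v • permMonomial σ) := by
    intro M hM
    rw [Finset.mem_filter] at hM
    obtain ⟨hMc, σ, hσ⟩ := hM
    refine Finset.mem_image.2 ⟨σ, Finset.mem_univ _, ?_⟩
    ext ⟨i, j⟩
    rw [ThinPatterns.apply_eq_of_aligned (hc M hMc) hσ i j, Finsupp.smul_apply, permMonomial_apply,
      smul_eq_mul]
    by_cases h : i = σ j
    · rw [if_pos h, if_pos h.symm, mul_one]
    · rw [if_neg h, if_neg (Ne.symm h), mul_zero]
  have _ := hv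
  calc _ ≤ ((Finset.univ : Finset (Equiv.Perm (Fin m))).image (fun σ => v • permMonomial σ)).card :=
        Finset.card_le_card hsub
    _ ≤ (Finset.univ : Finset (Equiv.Perm (Fin m))).card := Finset.card_image_le
    _ = m.factorial := by rw [Finset.card_univ, Fintype.card_perm, Fintype.card_fin]

/-- Sub-additivity of the pure count over sums (no cancellation needed: `support_sum`).
[folklore] -/
theorem card_pure_sum_le {m s : ℕ} (f : Fin s → MvPolynomial (Fin m × Fin m) ℝ≥0) :
    ((∑ t, f t).support.filter fun M => ∃ σ : Equiv.Perm (Fin m), ∀ e ∈ M.support, e.1 = σ e.2).card ≤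
      ∑ t, ((f t).support.filter fun M => ∃ σ : Equiv.Perm (Fin m), ∀ e ∈ M.support, e.1 = σ e.2).card := by
  classical
  calc _ ≤ ((Finset.univ : Finset (Fin s)).biUnion fun t => (f t).support.filter
          fun M => ∃ σ : Equiv.Perm (Fin m), ∀ e ∈ M.support, e.1 = σ e.2).card := by
        refine Finset.card_le_card fun M hM => ?_
        rw [Finset.mem_filter] at hM
        obtain ⟨t, -, ht⟩ := Finset.mem_biUnion.1 (support_sum hM.1)
        exact Finset.mem_biUnion.2 ⟨t, Finset.mem_univ _, Finset.mem_filter.2 ⟨ht, hM.2⟩⟩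
    _ ≤ _ := Finset.card_biUnion_le

/-- **Margins split** (general margins): if `a ≠ 0`, `b ≠ 0`, every exponent of `a · b` has
row margins `R` and column margins `C`, and `a` is torus-homogeneous with margins `(ρ, γ)`, then
`ρ ≤ R`, `γ ≤ C` and `b` is torus-homogeneous with margins `(R - ρ, C - γ)`. [folklore] -/
theorem margins_split_gen {m : ℕ} {a b : MvPolynomial (Fin m × Fin m) ℝ≥0} {R C ρ γ : Fin m → ℕ}
    (ha0 : a ≠ 0) (hb0 : b ≠ 0)
    (hab : ∀ M ∈ (a * b).support, (∀ i, ∑ j, M (i, j) = R i) ∧ (∀ j, ∑ i, M (i, j) = C j))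
    (ha : ∀ M ∈ a.support, (∀ i, ∑ j, M (i, j) = ρ i) ∧ (∀ j, ∑ i, M (i, j) = γ j)) :
    (∀ i, ρ i ≤ R i) ∧ (∀ j, γ j ≤ C j) ∧
      ∀ M ∈ b.support, (∀ i, ∑ j, M (i, j) = R i - ρ i) ∧ (∀ j, ∑ i, M (i, j) = C j - γ j) := by
  classical
  obtain ⟨A, hA⟩ := Finset.nonempty_iff_ne_empty.2 (support_nonempty.2 ha0).ne_empty
  have key : ∀ B ∈ b.support, (∀ i, ρ i + ∑ j, B (i, j) = R i) ∧ (∀ j, γ j + ∑ i, B (i, j) = C j) := by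
    intro B hB
    have hAB := hab (A + B) (ThinPatterns.add_mem_support_mul hA hB)
    refine ⟨fun i => ?_, fun j => ?_⟩
    · have h1 := hAB.1 i
      simp only [Finsupp.coe_add, Pi.add_apply, Finset.sum_add_distrib, (ha A hA).1 i] at h1
      exact h1
    · have h1 := hAB.2 j
      simp only [Finsupp.coe_add, Pi.add_apply, Finset.sum_add_distrib, (ha A hA).2 j] at h1
      exact h1
  obtain ⟨B, hB⟩ := Finset.nonempty_iff_ne_empty.2 (support_nonempty.2 hb0).ne_empty
  refine ⟨fun i => ?_, fun j => ?_, fun B' hB' => ⟨fun i => ?_, fun j => ?_⟩⟩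
  · have := (key B hB).1 i; omega
  · have := (key B hB).2 j; omega
  · have := (key B' hB').1 i; omega
  · have := (key B' hB').2 j; omega
/-! ### Arithmetic -/

/-- `Σ_v (f v − ⌊f v/3⌋) ≤ (Σ f) − ⌊(Σ f)/3⌋ + #s`. [folklore] -/
theorem sum_sub_div_three_le {α : Type*} [DecidableEq α] (s : Finset α) (f : α → ℕ) :
    ∑ v ∈ s, (f v - f v / 3) ≤ (∑ v ∈ s, f v) - (∑ v ∈ s, f v) / 3 + s.card := by
  induction s using Finset.induction_on with
  | empty => simp
  | insert a s ha ih =>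
    rw [Finset.sum_insert ha, Finset.sum_insert ha, Finset.card_insert_of_notMem ha]
    generalize ∑ v ∈ s, f v = F at ih ⊢
    generalize ∑ v ∈ s, (f v - f v / 3) = G at ih ⊢
    omega

/-- `Y − ⌊Y/3⌋` is monotone. [folklore] -/
theorem sub_div_three_mono {Y m : ℕ} (h : Y ≤ m) : Y - Y / 3 ≤ m - m / 3 := by omega

/-- The constants of the inductive step: `(D + 3^{(D+2)²})(3^{D+2} + 1) + 4·3^{(D+1)²} ≤ 3^{(D+3)²}`.
[folklore] -/
theorem const_step (D : ℕ) :
    (D + 3 ^ ((D + 2) ^ 2)) * (3 ^ (D + 2) + 1) + 4 * 3 ^ ((D + 1) ^ 2) ≤ 3 ^ ((D + 3) ^ 2) := by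
  have hp : 9 ≤ 3 ^ (D + 2) := by
    calc (9 : ℕ) = 3 ^ 2 := by norm_num
      _ ≤ 3 ^ (D + 2) := Nat.pow_le_pow_right (by norm_num) (by omega)
  have hDp : D ≤ 3 ^ (D + 2) := (Nat.lt_pow_self (by norm_num : 1 < 3)).le.trans
    (Nat.pow_le_pow_right (by norm_num) (by omega))
  have hq : 3 ^ (D + 2) ≤ 3 ^ ((D + 2) ^ 2) :=
    Nat.pow_le_pow_right (by norm_num) (by nlinarith)
  have hE : 3 ^ ((D + 1) ^ 2) ≤ 3 ^ ((D + 2) ^ 2) :=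
    Nat.pow_le_pow_right (by norm_num) (by nlinarith)
  have h3 : 3 ^ ((D + 3) ^ 2) = 3 * (3 ^ (D + 2)) ^ 2 * 3 ^ ((D + 2) ^ 2) := by
    rw [← pow_mul, ← pow_succ', ← pow_add]
    congr 1
    ring
  rw [h3]
  generalize 3 ^ (D + 2) = p at hp hDp hq ⊢
  generalize 3 ^ ((D + 2) ^ 2) = q at hq hE ⊢
  generalize 3 ^ ((D + 1) ^ 2) = r at hE ⊢
  have h1 : (D + q) * (p + 1) + 4 * r ≤ (q + q) * (p + 1) + 4 * q :=
    Nat.add_le_add (Nat.mul_le_mul_right _ (Nat.add_le_add_right (hDp.trans hq) _))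
      (Nat.mul_le_mul_left 4 hE)
  have h2 : (q + q) * (p + 1) + 4 * q = q * (2 * p + 6) := by ring
  have h3' : 2 * p + 6 ≤ 3 * p ^ 2 := by nlinarith
  calc (D + q) * (p + 1) + 4 * r ≤ q * (2 * p + 6) := h2 ▸ h1
    _ ≤ q * (3 * p ^ 2) := Nat.mul_le_mul_left q h3'
    _ = 3 * p ^ 2 * q := by ring

/-- The exponents of the inductive step: `3^{(D+1)²}(3^{D+2} + 1) + 1 ≤ 3^{(D+2)²}`. [folklore] -/
theorem expo_step (D : ℕ) :
    3 ^ ((D + 1) ^ 2) * (3 ^ (D + 2) + 1) + 1 ≤ 3 ^ ((D + 2) ^ 2) := by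
  have hp : 9 ≤ 3 ^ (D + 2) := by
    calc (9 : ℕ) = 3 ^ 2 := by norm_num
      _ ≤ 3 ^ (D + 2) := Nat.pow_le_pow_right (by norm_num) (by omega)
  have hr : 1 ≤ 3 ^ ((D + 1) ^ 2) := Nat.one_le_pow _ _ (by norm_num)
  have h3 : 3 ^ ((D + 2) ^ 2) = 3 ^ ((D + 1) ^ 2) * (3 ^ (D + 2) * 3 ^ (D + 1)) := by
    rw [← pow_add, ← pow_add]
    congr 1
    ring
  have hp1 : 3 ≤ 3 ^ (D + 1) := by
    calc (3 : ℕ) = 3 ^ 1 := by norm_num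
      _ ≤ 3 ^ (D + 1) := Nat.pow_le_pow_right (by norm_num) (by omega)
  rw [h3]
  generalize 3 ^ (D + 2) = p at hp ⊢
  generalize 3 ^ ((D + 1) ^ 2) = r at hr ⊢
  generalize 3 ^ (D + 1) = p' at hp1 ⊢
  have h1 : r * (p + 1) + 1 ≤ r * (p + 1) + r * (2 * p - 1) := by
    have : 1 ≤ r * (2 * p - 1) := Nat.one_le_iff_ne_zero.2 (Nat.mul_ne_zero (by omega) (by omega))
    omega
  calc r * (p + 1) + 1 ≤ r * (p + 1) + r * (2 * p - 1) := h1
    _ = r * (p * 3) := by rw [← Nat.mul_add]; congr 1; omega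
    _ ≤ r * (p * p') := Nat.mul_le_mul_left r (Nat.mul_le_mul_left p hp1)

/-- Threshold bookkeeping: big levels are large boards. [folklore] -/
theorem threshold_big {D m k kv : ℕ} (hm : 3 ^ ((D + 3) ^ 2) ≤ m) (hk1 : m < 3 * k)
    (hbig : k ≤ 3 ^ (D + 2) * kv) : 3 ^ ((D + 2) ^ 2) ≤ kv := by
  have h3 : 3 ^ ((D + 3) ^ 2) = 3 * 3 ^ (D + 2) * 3 ^ ((D + 2) ^ 2 + (D + 2)) := by
    rw [← pow_succ', ← pow_add]
    congr 1
    ring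
  have hle : 3 ^ ((D + 2) ^ 2) ≤ 3 ^ ((D + 2) ^ 2 + (D + 2)) :=
    Nat.pow_le_pow_right (by norm_num) (by omega)
  have hpos : 0 < 3 ^ (D + 2) := Nat.pow_pos (by norm_num)
  by_contra hlt
  push Not at hlt
  have : 3 * 3 ^ (D + 2) * 3 ^ ((D + 2) ^ 2 + (D + 2)) < 3 * 3 ^ (D + 2) * 3 ^ ((D + 2) ^ 2) := by
    calc 3 * 3 ^ (D + 2) * 3 ^ ((D + 2) ^ 2 + (D + 2)) = 3 ^ ((D + 3) ^ 2) := h3.symm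
      _ ≤ m := hm
      _ < 3 * k := hk1
      _ ≤ 3 * (3 ^ (D + 2) * kv) := Nat.mul_le_mul_left 3 hbig
      _ < 3 * (3 ^ (D + 2) * 3 ^ ((D + 2) ^ 2)) :=
          Nat.mul_lt_mul_of_pos_left (Nat.mul_lt_mul_of_pos_left hlt hpos) (by norm_num)
      _ = 3 * 3 ^ (D + 2) * 3 ^ ((D + 2) ^ 2) := by ring
  exact absurd (Nat.lt_of_mul_lt_mul_left this) (not_lt.2 hle)

/-- Threshold bookkeeping: the complement level is a large board. [folklore] -/
theorem threshold_compl {D m k : ℕ} (hm : 3 ^ ((D + 3) ^ 2) ≤ m) (hk2 : 3 * k ≤ 2 * m) :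
    3 ^ ((D + 2) ^ 2) ≤ m - k := by
  have hsq : (D + 2) ^ 2 + 1 ≤ (D + 3) ^ 2 := by
    calc (D + 2) ^ 2 + 1 ≤ (D + 2) ^ 2 + (2 * D + 5) := by omega
      _ = (D + 3) ^ 2 := by ring
  have hle : 3 * 3 ^ ((D + 2) ^ 2) ≤ 3 ^ ((D + 3) ^ 2) := by
    rw [← pow_succ']
    exact Nat.pow_le_pow_right (by norm_num) hsq
  omega


/-- Level sizes sum to the row support: `Σ_{v=1}^{N} #{ρ = v} = #{ρ ≠ 0}` when `ρ ≤ N`. [folklore] -/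
theorem sum_card_levels {m N : ℕ} (ρ : Fin m → ℕ) (hρN : ∀ i, ρ i ≤ N) :
    ∑ v ∈ Finset.Icc 1 N, (Finset.univ.filter fun i => ρ i = v).card =
      (Finset.univ.filter fun i => ρ i ≠ 0).card := by
  classical
  rw [Finset.card_eq_sum_card_fiberwise (f := ρ) (t := Finset.Icc 1 N)
    (fun i hi => Finset.mem_Icc.2 ⟨Nat.one_le_iff_ne_zero.2 (Finset.mem_filter.1 hi).2, hρN i⟩)]
  refine Finset.sum_congr rfl fun v hv => ?_
  rw [Finset.filter_filter]
  congr 1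
  ext i
  simp only [Finset.mem_filter, Finset.mem_univ, true_and]
  have h1 : 1 ≤ v := (Finset.mem_Icc.1 hv).1
  constructor
  · intro h; exact ⟨by omega, h⟩
  · intro h; exact h.2

/-! ### The level bounds of the inductive step -/

/-- **a-side level bound.**  For a level `v ≥ 1` of the typed factor `a` (which has a pure
exponent): a set `X` containing the level-`v` slices of all pure exponents of `a`, of size
controlled by the induction hypothesis on the compressed slice (BIG level) or by `k_v!` (SMALL
level). [folklore] -/
theorem a_level_bound {D m L k kv v : ℕ}
    (ih : ∀ m', 3 ^ ((D + 2) ^ 2) ≤ m' → ∀ N', 1 ≤ N' → ∀ g' : MvPolynomial (Fin m' × Fin m') ℝ≥0,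
      (∀ M ∈ g'.support, (∀ i, ∑ j, M (i, j) = N') ∧ (∀ j, ∑ i, M (i, j) = N')) →
      (g'.support.filter fun M => ∃ σ : Equiv.Perm (Fin m'), ∀ e ∈ M.support, e.1 = σ e.2).card *
          3 ^ (D * m') ≤
        (complexity g' + 1) ^ (3 ^ ((D + 1) ^ 2)) *
          (m'.factorial * ((m' + 1) ^ (3 ^ ((D + 1) ^ 2)) * 2 ^ (D * (m' - m' / 3) + 3 ^ ((D + 2) ^ 2)))))
    (hm : 3 ^ ((D + 3) ^ 2) ≤ m)
    {a : MvPolynomial (Fin m × Fin m) ℝ≥0} {ρ γ : Fin m → ℕ}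
    (hty : ∀ M ∈ a.support, (∀ i, ∑ j, M (i, j) = ρ i) ∧ (∀ j, ∑ i, M (i, j) = γ j))
    (hpure : ∃ A ∈ a.support, ∃ σ : Equiv.Perm (Fin m), ∀ e ∈ A.support, e.1 = σ e.2)
    (hk1 : m < 3 * k) (hLa : complexity a ≤ L) (hv : 1 ≤ v)
    (hkv : (Finset.univ.filter fun i => ρ i = v).card = kv) :
    ∃ X : Finset ((Fin m × Fin m) →₀ ℕ),
      (∀ A ∈ a.support, (∃ σ : Equiv.Perm (Fin m), ∀ e ∈ A.support, e.1 = σ e.2) →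
        A.filter (fun e => ρ e.1 = v) ∈ X) ∧
      X.card * 3 ^ (D * kv) ≤
        (if 3 ^ (D + 2) * kv < k then kv.factorial * 3 ^ (D * kv)
          else (L + 1) ^ (3 ^ ((D + 1) ^ 2)) * (kv.factorial *
            ((m + 1) ^ (3 ^ ((D + 1) ^ 2)) * 2 ^ (D * (kv - kv / 3) + 3 ^ ((D + 2) ^ 2))))) := by
  classical
  obtain ⟨hcardT, av, hLav, hmargv, hslv⟩ := LevelSlice.stub_levelSlice m a ρ γ v hv hty hpure
  set X := av.support.filter (fun M => ∃ σ : Equiv.Perm (Fin m), ∀ e ∈ M.support, e.1 = σ e.2)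
    with hXdef
  refine ⟨X, fun A hA hAp => ?_, ?_⟩
  · obtain ⟨σ, hσ⟩ := hAp
    exact Finset.mem_filter.2 ⟨hslv A hA ⟨σ, hσ⟩, σ, pure_filter hσ _⟩
  · -- compress the slice to the `kv`-board
    have hmargv' : ∀ M ∈ av.support,
        (∀ i, ∑ j, M (i, j) = if i ∈ (Finset.univ.filter fun i => ρ i = v) then v else 0) ∧
        (∀ j, ∑ i, M (i, j) = if j ∈ (Finset.univ.filter fun j => γ j = v) then v else 0) := by
      intro M hM
      refine ⟨fun i => ?_, fun j => ?_⟩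
      · simpa only [Finset.mem_filter, Finset.mem_univ, true_and] using (hmargv M hM).1 i
      · simpa only [Finset.mem_filter, Finset.mem_univ, true_and] using (hmargv M hM).2 j
    obtain ⟨a', hmarg', hLa', hcard'⟩ := BoardCompressionGen.stub_boardCompressionGen m kv v
      (Finset.univ.filter fun i => ρ i = v) (Finset.univ.filter fun j => γ j = v) av hkv
      (hcardT ▸ hkv) hv hmargv'
    have hX : X.card ≤ (a'.support.filter
        fun M => ∃ σ : Equiv.Perm (Fin kv), ∀ e ∈ M.support, e.1 = σ e.2).card := hcard'
    split_ifs with hsmall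
    · exact Nat.mul_le_mul_right _
        (hX.trans (card_pure_le_factorial hv a' fun M hM j => (hmarg' M hM).2 j))
    · have hbig : k ≤ 3 ^ (D + 2) * kv := not_lt.1 hsmall
      have hkvge : 3 ^ ((D + 2) ^ 2) ≤ kv := threshold_big hm hk1 hbig
      have hih := ih kv hkvge v hv a' hmarg'
      have hL' : complexity a' + 1 ≤ L + 1 := by
        have := hLa'.trans (hLav.trans hLa)
        omega
      have hkvm : kv + 1 ≤ m + 1 := by
        rw [← hkv]
        exact Nat.succ_le_succ ((Finset.card_filter_le _ _).trans (by simp))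
      calc X.card * 3 ^ (D * kv)
          ≤ (a'.support.filter
              fun M => ∃ σ : Equiv.Perm (Fin kv), ∀ e ∈ M.support, e.1 = σ e.2).card *
              3 ^ (D * kv) := Nat.mul_le_mul_right _ hX
        _ ≤ _ := hih
        _ ≤ _ := Nat.mul_le_mul (Nat.pow_le_pow_left hL' _) (Nat.mul_le_mul_left _
              (Nat.mul_le_mul_right _ (Nat.pow_le_pow_left hkvm _)))

/-- Two `Finsupp.filter`s along pointwise-equivalent predicates agree. [folklore] -/
theorem filter_congr_iff {α : Type*} (f : α →₀ ℕ) {p q : α → Prop} [DecidablePred p]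
    [DecidablePred q] (h : ∀ x, p x ↔ q x) : f.filter p = f.filter q := by
  ext x
  rw [Finsupp.filter_apply, Finsupp.filter_apply]
  by_cases hp : p x
  · rw [if_pos hp, if_pos ((h x).1 hp)]
  · rw [if_neg hp, if_neg (fun hq => hp ((h x).2 hq))]

/-- **b-side level bound.**  The level `ρ = 0` of the complement factor `b` (margins `N - ρ`):
a set `Y` containing the level-`0` slices of all pure exponents of `b`, of size controlled by the
induction hypothesis on the compressed slice (always a big board). [folklore] -/
theorem levelBoundB :
    ∀ {D m L N k₀ : ℕ},
      (∀ m', 3 ^ ((D + 2) ^ 2) ≤ m' → ∀ N', 1 ≤ N' → ∀ g' : MvPolynomial (Fin m' × Fin m') ℝ≥0,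
        (∀ M ∈ g'.support, (∀ i, ∑ j, M (i, j) = N') ∧ (∀ j, ∑ i, M (i, j) = N')) →
        (g'.support.filter fun M => ∃ σ : Equiv.Perm (Fin m'), ∀ e ∈ M.support, e.1 = σ e.2).card *
            3 ^ (D * m') ≤
          (complexity g' + 1) ^ (3 ^ ((D + 1) ^ 2)) *
            (m'.factorial * ((m' + 1) ^ (3 ^ ((D + 1) ^ 2)) * 2 ^ (D * (m' - m' / 3) + 3 ^ ((D + 2) ^ 2))))) →
      1 ≤ N →
      ∀ {b : MvPolynomial (Fin m × Fin m) ℝ≥0} {ρ γ : Fin m → ℕ}, (∀ i, ρ i ≤ N) →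
      (∀ M ∈ b.support, (∀ i, ∑ j, M (i, j) = N - ρ i) ∧ (∀ j, ∑ i, M (i, j) = N - γ j)) →
      (∃ B ∈ b.support, ∃ σ : Equiv.Perm (Fin m), ∀ e ∈ B.support, e.1 = σ e.2) →
      (Finset.univ.filter fun i => ρ i = 0).card = k₀ → 3 ^ ((D + 2) ^ 2) ≤ k₀ →
      k₀ ≤ m → complexity b ≤ 8 * L + 8 →
      ∃ Y : Finset ((Fin m × Fin m) →₀ ℕ),
        (∀ B ∈ b.support, (∃ σ : Equiv.Perm (Fin m), ∀ e ∈ B.support, e.1 = σ e.2) →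
          B.filter (fun e => ρ e.1 = 0) ∈ Y) ∧
        Y.card * 3 ^ (D * k₀) ≤
          16 ^ (3 ^ ((D + 1) ^ 2)) * (L + 1) ^ (3 ^ ((D + 1) ^ 2)) * (k₀.factorial *
            ((m + 1) ^ (3 ^ ((D + 1) ^ 2)) * 2 ^ (D * (k₀ - k₀ / 3) + 3 ^ ((D + 2) ^ 2)))) := by
  intro D m L N k₀ ih hN b ρ γ hρN htyb hpure hk₀ hk₀ge hk₀m hLb
  classical
  obtain ⟨hcard0, bN, hLbN, hmarg0, hsl0⟩ :=
    LevelSlice.stub_levelSlice m b (fun i => N - ρ i) (fun j => N - γ j) N hN htyb hpure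
  have hfilt : (Finset.univ.filter fun i => N - ρ i = N) = (Finset.univ.filter fun i => ρ i = 0) := by
    ext i
    simp only [Finset.mem_filter, Finset.mem_univ, true_and]
    have := hρN i
    omega
  set Y := bN.support.filter (fun M => ∃ σ : Equiv.Perm (Fin m), ∀ e ∈ M.support, e.1 = σ e.2)
    with hYdef
  refine ⟨Y, fun B hB hBp => ?_, ?_⟩
  · obtain ⟨σ, hσ⟩ := hBp
    have heq : B.filter (fun e => ρ e.1 = 0) = B.filter (fun e => N - ρ e.1 = N) :=
      filter_congr_iff B fun e => by have := hρN e.1; omega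
    rw [heq]
    exact Finset.mem_filter.2 ⟨hsl0 B hB ⟨σ, hσ⟩, σ, pure_filter hσ _⟩
  · have hS : (Finset.univ.filter fun i => N - ρ i = N).card = k₀ := by rw [hfilt, hk₀]
    have hT : (Finset.univ.filter fun j => N - γ j = N).card = k₀ := by rw [← hcard0, hS]
    have hmarg0' : ∀ M ∈ bN.support,
        (∀ i, ∑ j, M (i, j) = if i ∈ (Finset.univ.filter fun i => N - ρ i = N) then N else 0) ∧
        (∀ j, ∑ i, M (i, j) = if j ∈ (Finset.univ.filter fun j => N - γ j = N) then N else 0) := by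
      intro M hM
      refine ⟨fun i => ?_, fun j => ?_⟩
      · simpa only [Finset.mem_filter, Finset.mem_univ, true_and] using (hmarg0 M hM).1 i
      · simpa only [Finset.mem_filter, Finset.mem_univ, true_and] using (hmarg0 M hM).2 j
    obtain ⟨b', hmarg', hLb', hcard'⟩ := BoardCompressionGen.stub_boardCompressionGen m k₀ N
      (Finset.univ.filter fun i => N - ρ i = N) (Finset.univ.filter fun j => N - γ j = N) bN hS hT
      hN hmarg0'
    have hih := ih k₀ hk₀ge N hN b' hmarg'
    have hL' : complexity b' + 1 ≤ 16 * (L + 1) := by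
      have := hLb'.trans (hLbN.trans hLb)
      omega
    have hL'' : (complexity b' + 1) ^ (3 ^ ((D + 1) ^ 2)) ≤
        16 ^ (3 ^ ((D + 1) ^ 2)) * (L + 1) ^ (3 ^ ((D + 1) ^ 2)) := by
      rw [← mul_pow]
      exact Nat.pow_le_pow_left hL' _
    have hk₀m' : k₀ + 1 ≤ m + 1 := Nat.succ_le_succ hk₀m
    calc Y.card * 3 ^ (D * k₀)
        ≤ (b'.support.filter
            fun M => ∃ σ : Equiv.Perm (Fin k₀), ∀ e ∈ M.support, e.1 = σ e.2).card *
            3 ^ (D * k₀) := Nat.mul_le_mul_right _ hcard'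
      _ ≤ _ := hih
      _ ≤ _ := Nat.mul_le_mul hL'' (Nat.mul_le_mul_left _
            (Nat.mul_le_mul_right _ (Nat.pow_le_pow_left hk₀m' _)))

end Summit.ValiantsHypothesis.ValiantsHypothesis.Theorems.DivisionGap.PerMultiplesHard.DeepPureCount

end
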